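import Literature.AlgebraicGeometry.HodgeTheory.AtiyahClass
import HarnessLib

/-!
# The Atiyah class with torsion-safe coefficients `𝓗om(𝒯_{X/S}, E)` (any `𝒪_X`-module)

For a commutative ring `S`, an `S`-scheme `X : Over (Spec S)` and ANY `𝒪_X`-module `E` we construct
Atiyah's extension (Atiyah 1957, §4: "`D(S) = S ⊕ S ⊗ Ω¹`; if `α = s ⊕ β`, `f ∈ 𝒪_x`, we define
`f·α = fs ⊕ (fβ + s ⊗ df)`") with the twist `E ⊗ Ω¹_{X/S}` modelled as

  `twistTangentHom E := 𝓗om(𝒯_{X/S}, E)`,  `𝒯_{X/S} := (Ω¹_{X/S})^∨ = 𝓗om(Ω¹_{X/S}, 𝒪_X)`,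

and its Yoneda class `atiyahClass' E ∈ Ext¹_{𝒪_X}(E, 𝓗om(𝒯_{X/S}, E))` (Buchweitz–Flenner §1:
"`At(F) ∈ Ext¹_X(F, F ⊗ Ω¹_X)`, the Atiyah class of `F`", for every coherent — indeed every —
`𝒪_X`-module `F`).

## Why a second model (design)

`HodgeTheory/AtiyahClass.lean` models `E ⊗ Ω¹` as `𝓗om(E^∨, Ω¹)`, which is canonically `E ⊗ Ω¹`
only for `E` finite locally free, and is ZERO for a torsion sheaf (`E^∨ = 0`), so that its
`atiyahClass E` has zero target for `E = 𝒪_Z`, `i_* G`, … (recorded in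
`HodgeTheory/BlochSemiregularityMapReal.lean`). The present model puts the dual on the OTHER factor:
when `Ω¹_{X/S}` is finite locally free (e.g. `X → S` smooth), `𝓗om((Ω¹)^∨, E) ≅ E ⊗ Ω¹` for EVERY
`𝒪_X`-module `E` (Hartshorne II Ex. 5.1 (b) applied to the locally free factor), and the functor
`E ↦ 𝓗om(𝒯, E)` is exact. The twisting term of the module structure becomes
`δ'(a, s) = (θ ↦ θ(da) · s) ∈ Γ(𝓗om(𝒯, E), U)` — Atiyah's `s ⊗ df` read through
`E ⊗ Ω¹ → 𝓗om(𝒯, E)`, `s ⊗ ω ↦ (θ ↦ θ(ω) s)`. Everything else is the construction of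
`AtiyahClass.lean` line by line (same jet calculus, same gluing, same exactness argument).

## Contents (everything proved; no named facts)

* `tangentSheaf X = (Ω¹_{X/S})^∨`, `twistTangentHom E = 𝓗om(𝒯_{X/S}, E)`;
* `deltaHomCoh E U a s = (θ ↦ θ(da) s)` with its calculus (additivity, Leibniz rule, restriction);
* `JetSectionsCoh E U` — pairs `(s, φ)`, `φ ∈ Γ(𝓗om(𝒯, E), U)`, with the twisted module structure
  `a • (s, φ) = (a s, a φ + δ'(a, s))`; `jetModuleCoh E = P¹(E)` (a sheaf), `jetιCoh`, `jetπCoh`,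
  `jetShortComplexCoh_shortExact` (`0 → 𝓗om(𝒯, E) → P¹(E) → E → 0`);
* `atiyahClass' E : Ext¹(E, 𝓗om(𝒯_{X/S}, E))` — `ShortExact.extClass` of that sequence.

## Comparison with the tree's other models (stated, NOT proved here)

The tree now carries three models of `E ⊗ Ω¹_{X/S}` with an Atiyah extension valued in each:
`twistCotangent E = 𝓗om(E^∨, Ω¹)` with `atiyahClass E` (`HodgeTheory/AtiyahClass.lean`),
`twistHodge E 1 = 𝓗om(E^∨, ⋀¹Ω¹)` with the step class `atiyahClassStep E 0` / the power
`atiyahPowReal E 1` (`HodgeTheory/SemiregularityHigherSigma.lean`, `SemiregularityMapReal.lean`;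
there `atiyahClass_comp_hodgeSheafOneIso_inv` and `atiyahPowReal_one` PROVE that those two agree),
and the present `twistTangentHom E = 𝓗om((Ω¹)^∨, E)` with `atiyahClass' E`. When BOTH `E` and
`Ω¹_{X/S}` are finite locally free, biduality (`Modules.toBidual`; Hartshorne II Ex. 5.1 (a):
`E ≅ E^∨∨`, `Ω¹ ≅ (Ω¹)^∨∨`) gives a canonical isomorphism `𝓗om(E^∨, Ω¹) ≅ 𝓗om((Ω¹)^∨, E)` — in local
frames `(e_i)` of `E`, `Σ e_i ⊗ ω_i ↦ (θ ↦ Σ θ(ω_i) e_i)` — which, together with the identity on `E`,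
extends to an isomorphism of the jet sequences `jetShortComplex E ≅ jetShortComplexCoh E` (on sections
`(s, φ) ↦ (s, φ')`; the twisting terms `λ ↦ λ(s) da` and `θ ↦ θ(da) s` correspond), so that
`atiyahClass' E` is the image of `atiyahClass E` under the induced isomorphism
`Ext¹(E, 𝓗om(E^∨, Ω¹)) ≅ Ext¹(E, 𝓗om((Ω¹)^∨, E))` (naturality of `ShortExact.extClass`). This
comparison is NOT proved in this file: it needs `toBidual` to be an isomorphism for finite locally
free modules and the morphism of short complexes, and is recorded as the first follow-up. For a
TORSION sheaf `E` there is nothing to compare — the two older targets are `0`, the present one is not.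

Not here either: the Yoneda powers `At(E)^k` (staged separately as `HodgeTheory/AtiyahPowers.lean`)
and traces for non-locally-free `E` (Buchweitz–Flenner §4); functoriality of `P¹` in `E`.

## References

* M. F. Atiyah, *Complex analytic connections in fibre bundles*, Trans. AMS 85 (1957), §4
  (pp. 193–194: `D(S)`, `𝔅(S)`, `b(E)`). [Atiyah1957]
* R.-O. Buchweitz, H. Flenner, *A semiregularity map for modules and applications to deformations*,
  Compositio Math. 137 (2003), §1, §3 (Atiyah class of a module / perfect complex). [BuchweitzFlenner2003]
* R. Hartshorne, *Algebraic Geometry* (1977), II.8, II Ex. 5.1. [Hartshorne1977]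
-/

noncomputable section

open CategoryTheory CategoryTheory.Abelian AlgebraicGeometry Opposite TopologicalSpace Limits

namespace Literature.AlgebraicGeometry.HodgeTheory

open Literature.AlgebraicGeometry.Modules Literature.AlgebraicGeometry.Motives

universe w u

/-! ### Evaluation at the zero section -/

section EvalZero

variable {Y : Scheme.{u}} {E M : Y.Modules} {U : Y.Opens}

/-- `ev_0 = 0`: evaluation at the zero section is the zero morphism. [folklore] -/
@[simp]
private lemma evalAt_zero_coh : evalAt (M := M) (0 : Γ(E, U)) = 0 := by
  have h := evalAt_add (M := M) (0 : Γ(E, U)) 0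
  rw [add_zero] at h
  exact left_eq_add.mp h

end EvalZero

/-! ### The tangent sheaf and the torsion-safe twist `𝓗om(𝒯, E)` -/

section Twist

variable {S : Type u} [CommRing S] (X : Over (Spec (CommRingCat.of S)))

/-- **The tangent sheaf** `𝒯_{X/S} := (Ω¹_{X/S})^∨ = 𝓗om_{𝒪_X}(Ω¹_{X/S}, 𝒪_X)` of an `S`-scheme
(the dual of the tree's cotangent sheaf `Motives.cotangentSheaf X`). [cite: Hartshorne1977, II.8 (p. 180, the tangent sheaf as the dual of Ω)] -/
abbrev tangentSheaf : X.left.Modules := dual (cotangentSheaf X)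

variable {X} in
/-- **The torsion-safe twist `E ⊗ Ω¹_{X/S}`, modelled as `𝓗om(𝒯_{X/S}, E)`** (canonically
isomorphic to `E ⊗ Ω¹` for EVERY `𝒪_X`-module `E` as soon as `Ω¹_{X/S}` is finite locally free,
Hartshorne II Ex. 5.1 (b) applied to the locally free factor; exact in `E`). Its sections over `U`
are the morphisms `𝒯|_U → E|_U`. [cite: Hartshorne1977, II Ex. 5.1 (b)] -/
abbrev twistTangentHom (E : X.left.Modules) : X.left.Modules := sheafHom (tangentSheaf X) E

end Twist

/-! ### The twisting term `δ'(a, s) = (θ ↦ θ(da) s)` -/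

section Delta

variable {S : Type u} [CommRing S] {X : Over (Spec (CommRingCat.of S))}
variable (E : X.left.Modules) {U V : X.left.Opens}

/-- **The twisting term** `δ'(a, s) = (θ ↦ θ(da) · s) ∈ Γ(𝓗om(𝒯, E), U)` of the jet module structure
(`a ∈ Γ(X, U)`, `s ∈ Γ(E, U)`): evaluation of a tangent field at `da` followed by multiplication
by `s` — Atiyah's `s ⊗ da` read in `𝓗om(𝒯, E)`. [cite: Atiyah1957, §4 (the extension defining the Atiyah class)] -/
def deltaHomCoh (U : X.left.Opens) (a : Γ(X.left, U)) (s : Γ(E, U)) :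
    (tangentSheaf X).over U ⟶ E.over U :=
  evalAt (M := unitModule X.left) (dSection X U a) ≫ smulSection s

/-- **Values of `δ'(a, s)`**: `θ ↦ θ(da|) • s|` — Atiyah's twisting term `s ⊗ df` of
`f · (s ⊕ β) = fs ⊕ (fβ + s ⊗ df)`, read in `𝓗om(𝒯, E)`. [cite: Atiyah1957, §4 (p. 193, the module structure of D(S))] -/
lemma appLE_deltaHomCoh (a : Γ(X.left, U)) (s : Γ(E, U)) {W : X.left.Opens} (k : W ⟶ U)
    (θ : (cotangentSheaf X).over W ⟶ (unitModule X.left).over W) :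
    appLE (deltaHomCoh E U a s) k (θ : Γ(tangentSheaf X, W)) =
      (show Γ(X.left, W) from appLE θ (𝟙 W) ((cotangentSheaf X).presheaf.map k.op (dSection X U a))) •
        E.presheaf.map k.op s :=
  rfl

/-- `δ'` is additive in `a`. [folklore] -/
private lemma deltaHomCoh_add_left (a b : Γ(X.left, U)) (s : Γ(E, U)) :
    deltaHomCoh E U (a + b) s = deltaHomCoh E U a s + deltaHomCoh E U b s := by
  rw [deltaHomCoh, deltaHomCoh, deltaHomCoh, dSection_add, evalAt_add, Preadditive.add_comp]

/-- `δ'` is additive in `s`. [folklore] -/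
private lemma deltaHomCoh_add_right (a : Γ(X.left, U)) (s t : Γ(E, U)) :
    deltaHomCoh E U a (s + t) = deltaHomCoh E U a s + deltaHomCoh E U a t := by
  rw [deltaHomCoh, deltaHomCoh, deltaHomCoh, smulSection_add, Preadditive.comp_add]

/-- `δ'(1, s) = 0` (`d1 = 0`). [folklore] -/
@[simp]
private lemma deltaHomCoh_one (s : Γ(E, U)) : deltaHomCoh E U 1 s = 0 := by
  rw [deltaHomCoh, dSection_one, evalAt_zero_coh, zero_comp]

/-- `δ'(a, 0) = 0`. [folklore] -/
@[simp]
private lemma deltaHomCoh_zero_right (a : Γ(X.left, U)) : deltaHomCoh E U a 0 = 0 := by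
  rw [deltaHomCoh, smulSection_zero, comp_zero]

/-- `δ'(0, s) = 0` (`d0 = 0`). [folklore] -/
@[simp]
private lemma deltaHomCoh_zero_left (s : Γ(E, U)) : deltaHomCoh E U 0 s = 0 := by
  rw [deltaHomCoh, dSection_zero, evalAt_zero_coh, zero_comp]

/-- **Leibniz for `δ'`**: `δ'(ab, s) = a δ'(b, s) + b δ'(a, s)`. [folklore] -/
private lemma deltaHomCoh_mul (a b : Γ(X.left, U)) (s : Γ(E, U)) :
    deltaHomCoh E U (a * b) s = a • deltaHomCoh E U b s + b • deltaHomCoh E U a s := by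
  rw [deltaHomCoh, deltaHomCoh, deltaHomCoh, dSection_mul, evalAt_add, evalAt_smul, evalAt_smul,
    Preadditive.add_comp, smul_comp_overHom, smul_comp_overHom]

/-- `δ'(a, b s) = b δ'(a, s)`. [folklore] -/
private lemma deltaHomCoh_smul_right (a b : Γ(X.left, U)) (s : Γ(E, U)) :
    deltaHomCoh E U a (b • s) = b • deltaHomCoh E U a s := by
  rw [deltaHomCoh, deltaHomCoh, smulSection_smul, comp_smul_overHom]

/-- `δ'` commutes with restriction. [folklore] -/
private lemma restrictHom_deltaHomCoh (i : V ⟶ U) (a : Γ(X.left, U)) (s : Γ(E, U)) :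
    restrictHom i (deltaHomCoh E U a s) =
      deltaHomCoh E V (X.left.presheaf.map i.op a) (E.presheaf.map i.op s) := by
  rw [deltaHomCoh, deltaHomCoh, restrictHom_comp, restrictHom_evalAt, restrictHom_smulSection,
    map_dSection]

end Delta

/-! ### Jet sections with coefficients in `𝓗om(𝒯, E)` -/

section Jet

variable {S : Type u} [CommRing S] {X : Over (Spec (CommRingCat.of S))}
variable (E : X.left.Modules) {U V : X.left.Opens}

/-- **The sections of the first jet module** `P¹(E)` over `U` in the torsion-safe model: pairs
`(s, φ)` with `s ∈ Γ(E, U)` and `φ ∈ Γ(E ⊗ Ω¹, U)` modelled as `Hom(𝒯|_U, E|_U)`, with the TWISTED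
`𝒪(U)`-module structure `a • (s, φ) = (a s, a φ + δ'(a, s))`, verbatim Atiyah's
"`f · (s ⊕ β) = fs ⊕ (fβ + s ⊗ df)`". [cite: Atiyah1957, §4 (p. 193, the sheaf D(S))] -/
def JetSectionsCoh (E : X.left.Modules) (U : X.left.Opens) : Type u :=
  Γ(E, U) × ((tangentSheaf X).over U ⟶ E.over U)

namespace JetSectionsCoh

/-- Additive structure: componentwise. [folklore] -/
instance instAddCommGroup (U : X.left.Opens) : AddCommGroup (JetSectionsCoh E U) :=
  inferInstanceAs (AddCommGroup (Γ(E, U) × ((tangentSheaf X).over U ⟶ E.over U)))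

variable {E}

/-- Constructor. [folklore] -/
def mk (s : Γ(E, U)) (φ : (tangentSheaf X).over U ⟶ E.over U) : JetSectionsCoh E U := (s, φ)

/-- First component (the section of `E`). [folklore] -/
def fst (p : JetSectionsCoh E U) : Γ(E, U) := p.1

/-- Second component (the section of `E ⊗ Ω¹ = 𝓗om(𝒯, E)`). [folklore] -/
def snd (p : JetSectionsCoh E U) : (tangentSheaf X).over U ⟶ E.over U := p.2

/-- `(mk s φ).fst = s`. [folklore] -/
@[simp] private lemma fst_mk (s : Γ(E, U)) (φ : (tangentSheaf X).over U ⟶ E.over U) :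
    (mk s φ).fst = s := rfl
/-- `(mk s φ).snd = φ`. [folklore] -/
@[simp] private lemma snd_mk (s : Γ(E, U)) (φ : (tangentSheaf X).over U ⟶ E.over U) :
    (mk s φ).snd = φ := rfl
/-- `fst` is additive. [folklore] -/
@[simp] private lemma fst_add (p q : JetSectionsCoh E U) : (p + q).fst = p.fst + q.fst := rfl
/-- `snd` is additive. [folklore] -/
@[simp] private lemma snd_add (p q : JetSectionsCoh E U) : (p + q).snd = p.snd + q.snd := rfl
/-- `fst 0 = 0`. [folklore] -/
@[simp] private lemma fst_zero : (0 : JetSectionsCoh E U).fst = 0 := rfl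
/-- `snd 0 = 0`. [folklore] -/
@[simp] private lemma snd_zero : (0 : JetSectionsCoh E U).snd = 0 := rfl

/-- Extensionality for jet sections. [folklore] -/
@[ext]
private lemma ext {p q : JetSectionsCoh E U} (h₁ : p.fst = q.fst) (h₂ : p.snd = q.snd) : p = q :=
  Prod.ext h₁ h₂

/-- The twisted scalar multiplication `a • (s, φ) = (a s, a φ + δ'(a, s))` (Atiyah:
`f · (s ⊕ β) = fs ⊕ (fβ + s ⊗ df)`). [cite: Atiyah1957, §4 (p. 193)] -/
instance instSMul (U : X.left.Opens) : SMul Γ(X.left, U) (JetSectionsCoh E U) where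
  smul a p := mk (a • p.fst) (a • p.snd + deltaHomCoh E U a p.fst)

/-- First component of `a • p`. [folklore] -/
@[simp] private lemma fst_smul (a : Γ(X.left, U)) (p : JetSectionsCoh E U) : (a • p).fst = a • p.fst := rfl
/-- Second component of `a • p` (the twist). [folklore] -/
@[simp] private lemma snd_smul (a : Γ(X.left, U)) (p : JetSectionsCoh E U) :
    (a • p).snd = a • p.snd + deltaHomCoh E U a p.fst := rfl

/-- **The twisted action is a module structure** (Leibniz rule for `δ'`). [cite: Atiyah1957, §4] -/
instance instModule (U : X.left.Opens) : Module Γ(X.left, U) (JetSectionsCoh E U) where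
  one_smul p := JetSectionsCoh.ext (one_smul _ _) (by
    change (1 : Γ(X.left, U)) • p.snd + deltaHomCoh E U 1 p.fst = p.snd
    rw [one_smul, deltaHomCoh_one, add_zero])
  mul_smul a b p := JetSectionsCoh.ext (mul_smul a b p.fst) (by
    change (a * b) • p.snd + deltaHomCoh E U (a * b) p.fst =
      a • (b • p.snd + deltaHomCoh E U b p.fst) + deltaHomCoh E U a (b • p.fst)
    rw [deltaHomCoh_mul, deltaHomCoh_smul_right, mul_smul, smul_add]
    abel)
  smul_zero a := JetSectionsCoh.ext (smul_zero a) (by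
    change a • (0 : (tangentSheaf X).over U ⟶ E.over U) + deltaHomCoh E U a 0 = 0
    rw [smul_zero, deltaHomCoh_zero_right, add_zero])
  smul_add a p q := JetSectionsCoh.ext (smul_add a p.fst q.fst) (by
    change a • (p.snd + q.snd) + deltaHomCoh E U a (p.fst + q.fst) =
      (a • p.snd + deltaHomCoh E U a p.fst) + (a • q.snd + deltaHomCoh E U a q.fst)
    rw [smul_add, deltaHomCoh_add_right]
    abel)
  add_smul a b p := JetSectionsCoh.ext (add_smul a b p.fst) (by
    change (a + b) • p.snd + deltaHomCoh E U (a + b) p.fst =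
      (a • p.snd + deltaHomCoh E U a p.fst) + (b • p.snd + deltaHomCoh E U b p.fst)
    rw [add_smul, deltaHomCoh_add_left]
    abel)
  zero_smul p := JetSectionsCoh.ext (zero_smul _ p.fst) (by
    change (0 : Γ(X.left, U)) • p.snd + deltaHomCoh E U 0 p.fst = 0
    rw [zero_smul, deltaHomCoh_zero_left, add_zero])

/-- Restriction of jet sections: componentwise. [folklore] -/
def restrict (i : V ⟶ U) (p : JetSectionsCoh E U) : JetSectionsCoh E V :=
  mk (E.presheaf.map i.op p.fst) (restrictHom i p.snd)

/-- First component of a restricted jet section. [folklore] -/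
@[simp] private lemma fst_restrict (i : V ⟶ U) (p : JetSectionsCoh E U) :
    (restrict i p).fst = E.presheaf.map i.op p.fst := rfl
/-- Second component of a restricted jet section. [folklore] -/
@[simp] private lemma snd_restrict (i : V ⟶ U) (p : JetSectionsCoh E U) :
    (restrict i p).snd = restrictHom i p.snd := rfl

/-- Restriction is additive. [folklore] -/
def restrictAddHom (i : V ⟶ U) : JetSectionsCoh E U →+ JetSectionsCoh E V where
  toFun := restrict i
  map_zero' := JetSectionsCoh.ext (map_zero (E.presheaf.map i.op).hom) (restrictHom_zero i)
  map_add' p q := JetSectionsCoh.ext (map_add (E.presheaf.map i.op).hom p.fst q.fst)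
    (restrictHom_add i p.snd q.snd)

/-- Restriction is semilinear for the twisted structures. [folklore] -/
private lemma restrict_smul (i : V ⟶ U) (a : Γ(X.left, U)) (p : JetSectionsCoh E U) :
    restrict i (a • p) = X.left.presheaf.map i.op a • restrict i p :=
  JetSectionsCoh.ext (Scheme.Modules.map_smul E i a p.fst) (by
    change restrictHom i (a • p.snd + deltaHomCoh E U a p.fst) =
      X.left.presheaf.map i.op a • restrictHom i p.snd +
        deltaHomCoh E V (X.left.presheaf.map i.op a) (E.presheaf.map i.op p.fst)
    rw [restrictHom_add, restrictHom_smul, restrictHom_deltaHomCoh])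

end JetSectionsCoh

/-- The presheaf of abelian groups of jet sections (torsion-safe model). [folklore] -/
def jetPresheafAbCoh : TopCat.Presheaf Ab X.left where
  obj U := AddCommGrpCat.of (JetSectionsCoh E U.unop)
  map i := AddCommGrpCat.ofHom (JetSectionsCoh.restrictAddHom i.unop)
  map_id U := AddCommGrpCat.ext fun (p : JetSectionsCoh E U.unop) =>
    JetSectionsCoh.ext (presheaf_map_id E p.fst) (restrictHom_id' p.snd)
  map_comp i j := AddCommGrpCat.ext fun (p : JetSectionsCoh E _) =>
    JetSectionsCoh.ext (presheaf_map_map E i.unop j.unop p.fst).symm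
      (restrictHom_comp' i.unop j.unop p.snd)

/-- The presheaf of modules of jet sections (twisted module structures, semilinear restriction).
[cite: Atiyah1957, §4] -/
def jetPresheafCoh : X.left.PresheafOfModules :=
  @PresheafOfModules.ofPresheaf _ _ X.left.ringCatSheaf.obj (jetPresheafAbCoh E)
    (fun U => JetSectionsCoh.instModule (E := E) U.unop)
    (fun _ _ i a p => JetSectionsCoh.restrict_smul i.unop a p)

/-- **The jet presheaf is a sheaf**: pairs glue componentwise (`E` and `𝓗om(𝒯, E)` are sheaves).
[folklore] -/
private theorem isSheaf_jetPresheafCoh : TopCat.Presheaf.IsSheaf (jetPresheafCoh E).presheaf := by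
  refine (TopCat.Presheaf.isSheaf_iff_isSheafUniqueGluing _).2 fun ι U sf hsf => ?_
  -- the two components of the family and their compatibility
  let sf' : ∀ i, JetSectionsCoh E (U i) := sf
  let s₀ : ∀ i, Γ(E, U i) := fun i => (sf' i).fst
  let φ₀ : ∀ i, Γ(twistTangentHom E, U i) := fun i =>
    ((sf' i).snd : (tangentSheaf X).over (U i) ⟶ E.over (U i))
  have hs₀ : TopCat.Presheaf.IsCompatible E.presheaf U s₀ := fun i j =>
    congrArg JetSectionsCoh.fst (hsf i j)
  have hφ₀ : TopCat.Presheaf.IsCompatible (twistTangentHom E).presheaf U φ₀ := fun i j =>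
    congrArg JetSectionsCoh.snd (hsf i j)
  -- glue them separately
  obtain ⟨s, hs, hs'⟩ :=
    TopCat.Sheaf.existsUnique_gluing ((SheafOfModules.toSheaf X.left.ringCatSheaf).obj E) U s₀ hs₀
  obtain ⟨φ, hφ, hφ'⟩ :=
    TopCat.Sheaf.existsUnique_gluing ((SheafOfModules.toSheaf X.left.ringCatSheaf).obj
      (twistTangentHom E)) U φ₀ hφ₀
  refine ⟨(JetSectionsCoh.mk s φ : JetSectionsCoh E (iSup U)),
    fun i => JetSectionsCoh.ext (hs i) (hφ i), fun q hq => ?_⟩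
  exact JetSectionsCoh.ext (hs' (JetSectionsCoh.fst (q : JetSectionsCoh E (iSup U)))
    fun i => congrArg JetSectionsCoh.fst (hq i))
    (hφ' (JetSectionsCoh.snd (q : JetSectionsCoh E (iSup U))) fun i => congrArg JetSectionsCoh.snd (hq i))

/-- **The first jet module (Atiyah extension) `P¹(E)`** of an `𝒪_X`-module `E` on an `S`-scheme
`X`, torsion-safe model: the `𝒪_X`-module of pairs `(s, φ)`, `s ∈ E`, `φ ∈ E ⊗ Ω¹_{X/S}` (as
`𝓗om(𝒯_{X/S}, E)`), with `a · (s, φ) = (a s, a φ + s ⊗ da)`; it sits in the exact sequence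
`0 → 𝓗om(𝒯, E) → P¹(E) → E → 0` (`jetShortComplexCoh`, `jetShortComplexCoh_shortExact`) whose class
is the Atiyah class `atiyahClass' E`. [cite: Atiyah1957, §4] [cite: BuchweitzFlenner2003, §3 (Atiyah class)] -/
def jetModuleCoh : X.left.Modules where
  val := jetPresheafCoh E
  isSheaf := isSheaf_jetPresheafCoh E

/-- The inclusion `𝓗om(𝒯, E) → P¹(E)`, `φ ↦ (0, φ)`. [cite: Atiyah1957, §4] -/
def jetιCoh : twistTangentHom E ⟶ jetModuleCoh E where
  val := PresheafOfModules.homMk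
    { app := fun U => AddCommGrpCat.ofHom
        { toFun := fun φ : (tangentSheaf X).over U.unop ⟶ E.over U.unop =>
            (JetSectionsCoh.mk 0 φ : JetSectionsCoh E U.unop)
          map_zero' := rfl
          map_add' := fun φ ψ => JetSectionsCoh.ext (add_zero _).symm rfl }
      naturality := fun {U V} i =>
        AddCommGrpCat.ext fun (φ : (tangentSheaf X).over U.unop ⟶ E.over U.unop) =>
          JetSectionsCoh.ext (map_zero _).symm rfl }
    (fun U (a : Γ(X.left, U.unop)) (φ : (tangentSheaf X).over U.unop ⟶ E.over U.unop) =>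
      JetSectionsCoh.ext (smul_zero a).symm (by
        change a • φ = a • φ + deltaHomCoh E U.unop a 0
        rw [deltaHomCoh_zero_right, add_zero]))

/-- The projection `P¹(E) → E`, `(s, φ) ↦ s`. [cite: Atiyah1957, §4] -/
def jetπCoh : jetModuleCoh E ⟶ E where
  val := PresheafOfModules.homMk
    { app := fun U => AddCommGrpCat.ofHom
        { toFun := fun p : JetSectionsCoh E U.unop => p.fst
          map_zero' := rfl
          map_add' := fun _ _ => rfl }
      naturality := fun {U _} _ => AddCommGrpCat.ext fun (_ : JetSectionsCoh E U.unop) => rfl }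
    (fun U (_ : Γ(X.left, U.unop)) (_ : JetSectionsCoh E U.unop) => rfl)

/-- Sections of `jetιCoh`. [folklore] -/
@[simp]
private lemma jetιCoh_app_apply (U : X.left.Opens) (φ : (tangentSheaf X).over U ⟶ E.over U) :
    (jetιCoh E).app U φ = (JetSectionsCoh.mk 0 φ : JetSectionsCoh E U) := rfl

/-- Sections of `jetπCoh`. [folklore] -/
@[simp]
private lemma jetπCoh_app_apply (U : X.left.Opens) (p : JetSectionsCoh E U) :
    (jetπCoh E).app U p = p.fst := rfl

/-- `jetιCoh ≫ jetπCoh = 0`. [folklore] -/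
private lemma jetιCoh_comp_jetπCoh : jetιCoh E ≫ jetπCoh E = 0 :=
  Scheme.Modules.hom_ext _ _ fun _ => AddCommGrpCat.ext fun _ => rfl

/-- **The Atiyah sequence** `0 → 𝓗om(𝒯_{X/S}, E) → P¹(E) → E → 0` (torsion-safe model) as a short
complex. [cite: Atiyah1957, §4] [cite: BuchweitzFlenner2003, §3] -/
def jetShortComplexCoh : ShortComplex X.left.Modules :=
  ShortComplex.mk (jetιCoh E) (jetπCoh E) (jetιCoh_comp_jetπCoh E)

/-- **The Atiyah sequence is short exact** (it is even split as a sequence of abelian sheaves).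
[cite: Atiyah1957, §4] [cite: BuchweitzFlenner2003, §3] -/
theorem jetShortComplexCoh_shortExact : (jetShortComplexCoh E).ShortExact where
  exact := by
    rw [← ShortComplex.exact_map_iff_of_faithful (jetShortComplexCoh E) (modulesToSheaf X.left)]
    refine sheaf_exact_of_sections _ _ fun U (p : JetSectionsCoh E U.unop) (hp : p.fst = 0) => ?_
    exact ⟨p.snd, JetSectionsCoh.ext hp.symm rfl⟩
  mono_f := mono_of_injective_app (jetιCoh E) fun U φ ψ h => congrArg JetSectionsCoh.snd h
  epi_g := epi_of_surjective_app (jetπCoh E) fun U s => ⟨JetSectionsCoh.mk s 0, rfl⟩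

variable [HasExt.{w} X.left.Modules]

/-- **The Atiyah class with torsion-safe coefficients**
`At(E) ∈ Ext¹_{𝒪_X}(E, 𝓗om(𝒯_{X/S}, E))` of ANY `𝒪_X`-module `E` on an `S`-scheme: the Yoneda
class (Mathlib `ShortExact.extClass`) of the jet sequence `0 → 𝓗om(𝒯, E) → P¹(E) → E → 0`.
"`At(F) ∈ Ext¹_X(F, F ⊗ Ω¹_X)`, the Atiyah class of `F`" — here with `F ⊗ Ω¹` modelled as
`𝓗om((Ω¹)^∨, F)`, which is `≅ F ⊗ Ω¹` for every `F` when `Ω¹_{X/S}` is finite locally free (so the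
target is NOT zero for torsion `F`, unlike `atiyahClass`). Same sign convention as `atiyahClass`
(the class of Atiyah's extension `𝔅(E)`).
[cite: BuchweitzFlenner2003, §1 and §3 (Atiyah class)] [cite: Atiyah1957, §4] -/
def atiyahClass' : Ext.{w} E (twistTangentHom E) 1 :=
  (jetShortComplexCoh_shortExact E).extClass

end Jet

end Literature.AlgebraicGeometry.HodgeTheory

end
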